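/-
Copyright (c) 2026 the pub-hodgecm-mathlib formalisation cell (harness21).  Prover seat hodgecm-mathlib-K2E1-p10 (g6), Track B ∕ K2-LIT, h413 =
`stmt-HodgeConjecture-24833`, route `HCCMUnconditional`; R90-TF S8 «ContSpec-n½», (M) socket road: FILE B ED. 7 :299 `sock_S8_res_middleResidue_isPiN`
HYPOTHESIS-FIRST, ED. 3 (RES-INT line 7 (7c), census `K2/K2E1-p10/g6/CENSUS-LINE7-Packaging.K2E1-p10-g6.md` d2e571fc812fd5b2).
-/
import Summits.HodgeConjecture.HodgeConjecture.Theorems.R90S8ResMiddleResidueIsPiNOfLettersV2U3         -- ★ p864766 (this seat) ED. 2: `res_middleResidue_isPiN_of_quotients`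
import Summits.HodgeConjecture.HodgeConjecture.Theorems.R90S8DiscreteIrreducibleAdmissibleU3Statement    -- ★ p864593 (K2E1-p14) J-S8-ADM: `localConstituent_subsingleton_cm_three_of_AFA`
import Literature.NumberTheory.Automorphic.IrreducibleClassesComap                                      -- ★ `IrrClass.comap_injective`
import HarnessLib

/-!
# R90 · S8 «ContSpec-n½» — `R90S8ResMiddleResidueIsPiNOfConstituentU3`: the (M) socket `sock_S8_res_middleResidue_isPiN` (B ED. 7 :299) HYPOTHESIS-FIRST, ED. 3 —
# «EVERY local constituent is a quotient» (ED. 2's pins (QUOT-S)∕(QUOT-N)) from «SOME local constituent is a quotient» ((ONE-S)∕(ONE-N), the RES-INT line-7 output of ★ (7b)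
# p865019) and the printed letter «AFA» (one constituent class per place, ★ p864593) [Rogawski1990 §13.1, §13.9; FlathCorvallis1979 Thm. 3; MoeglinWaldspurger1995 IV.1.11]

Cell `pub/hodgecm-mathlib`, crux H413 = `stmt-HodgeConjecture-24833` (lane `--kind proof --supports stmt-HodgeConjecture-24833 --as helper`), route of record
`HCCMUnconditional`; programme R90-TF, section S8, the (M) socket road.  THEOREMS ONLY (no `def`, no `instance`, no `notation`, no `sorry`).  CLOSES NO SOCKET: the (M) :299
`sorry` stays until the ONE-constituent letters are discharged ((7d) «`P′ ∩ Res(V_τ) ≠ 0`» + the section dictionary + FACT-N, through ★ (7b) `exists_isConstituentOf_equiv_quotientRep_of_meets_iSup_range`).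

THE STEP (census (1): «by ★ hAF one-class-per-place it suffices to EXHIBIT ONE quotient-shaped constituent of `P′` at `v`»).  ED. 2 (★ p864766 `res_middleResidue_isPiN_of_quotients`) closes
the socket's ∃-body from the printed letters `hLQ` (SPLIT-LQ), `hKO` (ORIENT) and two pins quantified over EVERY `v`-constituent class of `P′`.  Under «AFA» (★ Literature named fact
`UnitaryGroup.AutomorphicFlathAdmissible`, the hypothesis `hAF` — a CONDITIONAL input exactly as in ★ p864593) two constituent classes of `P′.finRep.smoothPart ∘ inclPlace v` COINCIDE
(★ `localConstituent_subsingleton_cm_three_of_AFA`), and `IrrClass.comap` along the place isomorphism `localPiEquiv` is injective (★ `IrrClass.comap_injective`); so a pin over every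
constituent follows from its instance at ONE constituent: (QUOT-S) ⟸ (ONE-S) ∧ AFA, (QUOT-N) ⟸ (ONE-N) ∧ AFA (§1), and the head (§2) is ED. 2 over {`hLQ`, `hKO`, `hAF`, (ONE-S), (ONE-N)}.
(ONE-N) is, at each non-split `v` and along the frame of ★ `KeysOrientation` (ii), LITERALLY the output shape of ★ (7b) `exists_isConstituentOf_equiv_quotientRep_of_meets_iSup_range`
(`∃ r, (IrrClass.mk r).IsConstituentOf _ ∧ Nonempty (r.ρ.Equiv K.quotientRep)`) read through `IrrClass.comap (cmDatumLocalCongr …)`; (ONE-S) likewise at split `v` with ★ p864513's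
`parabolicIndGL` quotient map `q`.
* §1 `quotS_of_oneS_of_AFA`, `quotN_of_oneN_of_AFA` — the two upgrades, stated on the pin bodies of ★ p864766 byte for byte.
* §2 **`res_middleResidue_isPiN_of_constituent`** — (M) :299's ∃-body from `hLQ`, `hKO`, `hAF`, (ONE-S), (ONE-N).
HONEST LABEL: HC_CM is proved only modulo the 7 printed citations (2 remaining named inputs: hLiu418 = `stmt-HodgeConjecture-24832`, h413 = `stmt-HodgeConjecture-24833`) until
rung 0 closes; this file is hypothesis-first («AFA» named, ONE-letters visible), pays no socket; count-neutral.

## References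
* [Rogawski1990] J. D. Rogawski, *Automorphic Representations of Unitary Groups in Three Variables*, Ann. of Math. Stud. 123 (1990), §12.2 pp. 173–174; §13.1 p. 199; §13.9 (ii) p. 229.
* [FlathCorvallis1979] D. Flath, *Decomposition of representations into tensor products*, Proc. Sympos. Pure Math. 33.1 (1979), Thm. 3.
* [BorelJacquetCorvallis1979] A. Borel, H. Jacquet, *Automorphic forms and automorphic representations*, Proc. Sympos. Pure Math. 33.1 (1979), §4.6.
* [MoeglinWaldspurger1995] C. Mœglin, J.-L. Waldspurger, *Spectral Decomposition and Eisenstein Series* (1995), IV.1.11, V.3.13.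
-/

set_option autoImplicit false
-- the mandated namespace repeats the single-problem summit's segment (`HodgeConjecture.HodgeConjecture`)
set_option linter.dupNamespace false

noncomputable section

open MeasureTheory NumberField IsDedekindDomain
open scoped Matrix MatrixGroups
open Literature.NumberTheory.GaloisRepresentations Literature.NumberTheory.Automorphic.Arthur2013.Leaves.TECR
open Literature.NumberTheory.GaloisRepresentations.IsNonarchimedeanLocalField
open Literature.NumberTheory.Automorphic Literature.NumberTheory.Automorphic.UnitaryGroup Literature.NumberTheory.Rogawski1990

namespace Summit.HodgeConjecture.HodgeConjecture.R90.S8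

variable (L : Type) [Field L] [NumberField L] [IsCMField L]

/-! ## §1 The two upgrades: a pin over EVERY constituent from its instance at ONE constituent, under «AFA» -/

set_option synthInstance.maxHeartbeats 400000 in
set_option maxHeartbeats 4000000 in -- as ★ p864766 (the statement spells ★ `parabolicIndGL` + the split frame)
/-- **(QUOT-S) ⟸ (ONE-S) ∧ AFA.**  At a split place `v`, if SOME constituent class of `P′.finRep.smoothPart ∘ inclPlace v` is `⟦π⟧` with `π` (transported to `GL₃(L_w)`) an irreducible quotient of
the split principal series at the residual exponent, then EVERY constituent class is — two constituent classes coincide under «AFA» (★ `localConstituent_subsingleton_cm_three_of_AFA`) and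
`IrrClass.comap (localPiEquiv …)` is injective (★ `IrrClass.comap_injective`).  Binders = ★ p864766's (QUOT-S) body byte for byte. [cite: FlathCorvallis1979, Thm. 3] [cite: Rogawski1990, §13.1 p. 199] -/
theorem quotS_of_oneS_of_AFA
    (μ : Measure (quasiSplit (↥(maximalRealSubfield L)) L (IsCMField.complexConj L) 3).automorphicQuotient)
    [(quasiSplit (↥(maximalRealSubfield L)) L (IsCMField.complexConj L) 3).IsAutomorphicMeasure μ]
    (μω : HeckeCharacter L) (ξ : OneDimAutRepH L) (P' : DiscreteAutomorphicRep (quasiSplit (↥(maximalRealSubfield L)) L (IsCMField.complexConj L) 3) μ)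
    -- the printed global letter «AFA» (Flath ∕ Harish-Chandra ∕ Bernstein ∕ Borel–Jacquet §4.6): one local constituent class per finite place
    (hAF : AutomorphicFlathAdmissible (↥(maximalRealSubfield L)) L (IsCMField.complexConj L) 3 ((StdForm.antidiagonal 3).over L) μ)
    (v : HeightOneSpectrum (𝓞 ↥(maximalRealSubfield L))) (hs : ∃ w : PlacesOver L v, IsCMField.complexConj L • w.1 ≠ w.1)
    (hONE : ∃ c : IrrClass ((quasiSplit (↥(maximalRealSubfield L)) L (IsCMField.complexConj L) 3).Local v),
      (IrrClass.comap (localPiEquiv L (IsCMField.complexConj L) 3 ((StdForm.antidiagonal 3).over L) v) c).IsConstituentOf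
          (P'.finRep.smoothPart.toRepresentation.comp
            (inclPlace (↥(maximalRealSubfield L)) L (IsCMField.complexConj L) 3 ((StdForm.antidiagonal 3).over L) v)) ∧
        ∃ (π : SmoothIrrep ((cmDatum L 3 ((StdForm.antidiagonal 3).over L)).Local v)), IrrClass.mk π = c ∧
          ∃ q : (Representation.parabolicIndGL ((splitWitness v hs).1.adicCompletion L) (id : Fin 3 → Fin 3)
              ((Representation.trivial ℂ (Π a : Fin 3, GL {i : Fin 3 // (id : Fin 3 → Fin 3) i = a} ((splitWitness v hs).1.adicCompletion L)) ℂ).twist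
                (∏ a : Fin 3, ((![ξ.splitν₀ μω (splitWitness v hs).1 *
                        ((unramifiedTwist ((splitWitness v hs).1.adicCompletion L) (1 / 2) : QuasiChar ((splitWitness v hs).1.adicCompletion L)).toMonoidHom),
                      ξ.locψ (splitWitness v hs).1,
                      ξ.splitν₀ μω (splitWitness v hs).1 *
                        ((unramifiedTwist ((splitWitness v hs).1.adicCompletion L) (1 / 2) : QuasiChar ((splitWitness v hs).1.adicCompletion L)).toMonoidHom)⁻¹] :
                    Fin 3 → (((splitWitness v hs).1.adicCompletion L)ˣ →* ℂˣ)) a).comp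
                  (Matrix.GeneralLinearGroup.det.comp (Pi.evalMonoidHom (fun a : Fin 3 => GL {i : Fin 3 // (id : Fin 3 → Fin 3) i = a} ((splitWitness v hs).1.adicCompletion L)) a))))).IntertwiningMap
              (π.comap (cmSplitEquiv L ((StdForm.antidiagonal 3).over L) (UnitaryGroup.cmConj_antidiagonal_transpose L 3)
                ((Matrix.isUnit_iff_isUnit_det _).mp (StdForm.isUnit_over (StdForm.antidiagonal 3) L)) v (splitWitness v hs) (splitWitness_spec v hs)).symm).ρ,
            Function.Surjective q)
    (c : IrrClass ((quasiSplit (↥(maximalRealSubfield L)) L (IsCMField.complexConj L) 3).Local v))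
    (hc : (IrrClass.comap (localPiEquiv L (IsCMField.complexConj L) 3 ((StdForm.antidiagonal 3).over L) v) c).IsConstituentOf
          (P'.finRep.smoothPart.toRepresentation.comp
            (inclPlace (↥(maximalRealSubfield L)) L (IsCMField.complexConj L) 3 ((StdForm.antidiagonal 3).over L) v))) :
    ∃ (π : SmoothIrrep ((cmDatum L 3 ((StdForm.antidiagonal 3).over L)).Local v)), IrrClass.mk π = c ∧
      ∃ q : (Representation.parabolicIndGL ((splitWitness v hs).1.adicCompletion L) (id : Fin 3 → Fin 3)
          ((Representation.trivial ℂ (Π a : Fin 3, GL {i : Fin 3 // (id : Fin 3 → Fin 3) i = a} ((splitWitness v hs).1.adicCompletion L)) ℂ).twist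
            (∏ a : Fin 3, ((![ξ.splitν₀ μω (splitWitness v hs).1 *
                    ((unramifiedTwist ((splitWitness v hs).1.adicCompletion L) (1 / 2) : QuasiChar ((splitWitness v hs).1.adicCompletion L)).toMonoidHom),
                  ξ.locψ (splitWitness v hs).1,
                  ξ.splitν₀ μω (splitWitness v hs).1 *
                    ((unramifiedTwist ((splitWitness v hs).1.adicCompletion L) (1 / 2) : QuasiChar ((splitWitness v hs).1.adicCompletion L)).toMonoidHom)⁻¹] :
                Fin 3 → (((splitWitness v hs).1.adicCompletion L)ˣ →* ℂˣ)) a).comp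
              (Matrix.GeneralLinearGroup.det.comp (Pi.evalMonoidHom (fun a : Fin 3 => GL {i : Fin 3 // (id : Fin 3 → Fin 3) i = a} ((splitWitness v hs).1.adicCompletion L)) a))))).IntertwiningMap
          (π.comap (cmSplitEquiv L ((StdForm.antidiagonal 3).over L) (UnitaryGroup.cmConj_antidiagonal_transpose L 3)
            ((Matrix.isUnit_iff_isUnit_det _).mp (StdForm.isUnit_over (StdForm.antidiagonal 3) L)) v (splitWitness v hs) (splitWitness_spec v hs)).symm).ρ,
        Function.Surjective q := by
  obtain ⟨c₀, hc₀, π, hπ, q, hq⟩ := hONE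
  have hcc : c = c₀ := IrrClass.comap_injective _ (localConstituent_subsingleton_cm_three_of_AFA L hAF P' v hc hc₀).1
  subst hcc
  exact ⟨π, hπ, q, hq⟩

set_option synthInstance.maxHeartbeats 400000 in
set_option maxHeartbeats 4000000 in -- as ★ p864766 (the statement spells ★ `cmPrincipalSeries` + `Representation.quotient`)
/-- **(QUOT-N) ⟸ (ONE-N) ∧ AFA.**  At a non-split place `v` and along a frame `(T, a, ha, h)`, if SOME constituent class `c₀` of `P′.finRep.smoothPart ∘ inclPlace v` has `comap e c₀ = ⟦r⟧` with
`r ≅ i_G(χ_{ξ,v}) ∕ N`, then EVERY constituent class does (★ `localConstituent_subsingleton_cm_three_of_AFA` + ★ `IrrClass.comap_injective`).  Binders = ★ p864766's (QUOT-N) body byte for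
byte. [cite: FlathCorvallis1979, Thm. 3] [cite: Rogawski1990, §12.2 pp. 173–174; §13.1 p. 199] -/
theorem quotN_of_oneN_of_AFA
    (μ : Measure (quasiSplit (↥(maximalRealSubfield L)) L (IsCMField.complexConj L) 3).automorphicQuotient)
    [(quasiSplit (↥(maximalRealSubfield L)) L (IsCMField.complexConj L) 3).IsAutomorphicMeasure μ]
    (μω : HeckeCharacter L) (ξ : OneDimAutRepH L) (P' : DiscreteAutomorphicRep (quasiSplit (↥(maximalRealSubfield L)) L (IsCMField.complexConj L) 3) μ)
    -- the printed global letter «AFA» (Flath ∕ Harish-Chandra ∕ Bernstein ∕ Borel–Jacquet §4.6): one local constituent class per finite place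
    (hAF : AutomorphicFlathAdmissible (↥(maximalRealSubfield L)) L (IsCMField.complexConj L) 3 ((StdForm.antidiagonal 3).over L) μ)
    (v : HeightOneSpectrum (𝓞 ↥(maximalRealSubfield L))) (T : GL (Fin 3) (LocalRing L v)) (a : LocalRing L v) (ha : IsUnit a)
    (h : formCongr (conjLocal L (IsCMField.complexConj L) v) T (((StdForm.antidiagonal 3).over L).map (algebraMap L (LocalRing L v))) =
      a • (Matrix.of fun i j : Fin 3 => if i.val + j.val + 1 = 3 then (1 : L) else 0).map (algebraMap L (LocalRing L v)))
    (hONE : ∃ c : IrrClass ((quasiSplit (↥(maximalRealSubfield L)) L (IsCMField.complexConj L) 3).Local v),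
      (IrrClass.comap (localPiEquiv L (IsCMField.complexConj L) 3 ((StdForm.antidiagonal 3).over L) v) c).IsConstituentOf
          (P'.finRep.smoothPart.toRepresentation.comp
            (inclPlace (↥(maximalRealSubfield L)) L (IsCMField.complexConj L) 3 ((StdForm.antidiagonal 3).over L) v)) ∧
            ∃ (r : SmoothIrrep (Gqs L v))
              (N : Subrepresentation (cmPrincipalSeries L 3 v (cmXiTorusChar L v (μω.semilocalComponent L v)
                (torusLocalComponent L (IsCMField.complexConj L) v ξ.η) (torusLocalComponent L (IsCMField.complexConj L) v ξ.ψ)))),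
              IrrClass.comap (cmDatumLocalCongr L v T ha h) c = IrrClass.mk r ∧
              Nonempty (r.ρ.Equiv ((cmPrincipalSeries L 3 v (cmXiTorusChar L v (μω.semilocalComponent L v)
                (torusLocalComponent L (IsCMField.complexConj L) v ξ.η) (torusLocalComponent L (IsCMField.complexConj L) v ξ.ψ))).quotient N.toSubmodule
                  fun g _ hx => N.apply_mem_toSubmodule g hx)))
    (c : IrrClass ((quasiSplit (↥(maximalRealSubfield L)) L (IsCMField.complexConj L) 3).Local v))
    (hc : (IrrClass.comap (localPiEquiv L (IsCMField.complexConj L) 3 ((StdForm.antidiagonal 3).over L) v) c).IsConstituentOf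
          (P'.finRep.smoothPart.toRepresentation.comp
            (inclPlace (↥(maximalRealSubfield L)) L (IsCMField.complexConj L) 3 ((StdForm.antidiagonal 3).over L) v))) :
    ∃ (r : SmoothIrrep (Gqs L v))
      (N : Subrepresentation (cmPrincipalSeries L 3 v (cmXiTorusChar L v (μω.semilocalComponent L v)
        (torusLocalComponent L (IsCMField.complexConj L) v ξ.η) (torusLocalComponent L (IsCMField.complexConj L) v ξ.ψ)))),
      IrrClass.comap (cmDatumLocalCongr L v T ha h) c = IrrClass.mk r ∧
      Nonempty (r.ρ.Equiv ((cmPrincipalSeries L 3 v (cmXiTorusChar L v (μω.semilocalComponent L v)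
        (torusLocalComponent L (IsCMField.complexConj L) v ξ.η) (torusLocalComponent L (IsCMField.complexConj L) v ξ.ψ))).quotient N.toSubmodule
          fun g _ hx => N.apply_mem_toSubmodule g hx)) := by
  obtain ⟨c₀, hc₀, r, N, hr, e⟩ := hONE
  have hcc : c = c₀ := IrrClass.comap_injective _ (localConstituent_subsingleton_cm_three_of_AFA L hAF P' v hc hc₀).1
  subst hcc
  exact ⟨r, N, hr, e⟩

/-! ## §2 The head: (M) :299 from ONE quotient-shaped constituent per place, modulo ORIENT, SPLIT-LQ and «AFA» -/

set_option synthInstance.maxHeartbeats 400000 in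
set_option maxHeartbeats 4000000 in -- as ★ p864766 (ED. 2's statement budget)
/-- **(M) :299 OF ONE CONSTITUENT — `res_middleResidue_isPiN_of_constituent` (ED. 3 of ★ `res_middleResidue_isPiN_of_letters`).**  ★ p864766's frame and conclusion (the socket's ∃-body
BYTE FOR BYTE) with the pins (QUOT-S)∕(QUOT-N) («EVERY constituent is a quotient») replaced by (ONE-S)∕(ONE-N) («SOME constituent is a quotient» — the output shape of ★ (7b)
`exists_isConstituentOf_equiv_quotientRep_of_meets_iSup_range` per place) and the printed letter `hAF` («AFA»: one constituent class per place, ★ p864593).  VISIBLE after this file: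
{`hKO`, `hLQ`, `hAF`, (ONE-S), (ONE-N)}; (ONE-·) ⟸ RES-INT (★ lines 1–6) ∘ KER ★ p864667 ∘ FACT-N (★ p864847, LH4-p10) ∘ section dictionary ∘ (7d) «`P′ ∩ Res(V_τ) ≠ 0`» ∘ ★ (7b) p865019.
[cite: Rogawski1990, §12.2 pp. 173–174; §13.1 p. 199; §13.9 (ii) p. 229] [cite: FlathCorvallis1979, Thm. 3] [cite: MoeglinWaldspurger1995, IV.1.11] -/
theorem res_middleResidue_isPiN_of_constituent
    (μ : Measure (quasiSplit (↥(maximalRealSubfield L)) L (IsCMField.complexConj L) 3).automorphicQuotient)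
    [(quasiSplit (↥(maximalRealSubfield L)) L (IsCMField.complexConj L) 3).IsAutomorphicMeasure μ]
    (μω : HeckeCharacter L) (hμu : μω.IsUnitary)
    (hμω : ∀ x : Literature.NumberTheory.GaloisRepresentations.ideleGroup ↥(maximalRealSubfield L),
      μω (AdeleRing.ideleBaseChange (↥(maximalRealSubfield L)) L x) = quadraticHeckeCharCM L x)
    (ξ : OneDimAutRepH L) (P' : DiscreteAutomorphicRep (quasiSplit (↥(maximalRealSubfield L)) L (IsCMField.complexConj L) 3) μ)
    -- the two printed local letters
    (hLQ : Zelevinsky1980.parabolicIndGL_three_oneLink_quotient_equiv_detChar) (hKO : KeysOrientation L)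
    -- the printed global letter «AFA» (Flath ∕ Harish-Chandra ∕ Bernstein ∕ Borel–Jacquet §4.6): one local constituent class per finite place
    (hAF : AutomorphicFlathAdmissible (↥(maximalRealSubfield L)) L (IsCMField.complexConj L) 3 ((StdForm.antidiagonal 3).over L) μ)
    -- (ONE-S): at a split place SOME local constituent of `P′` is an irreducible QUOTIENT of the split principal series at the residual exponent
    (hONEs : ∀ (v : HeightOneSpectrum (𝓞 ↥(maximalRealSubfield L))) (hs : ∃ w : PlacesOver L v, IsCMField.complexConj L • w.1 ≠ w.1),
      ∃ c : IrrClass ((quasiSplit (↥(maximalRealSubfield L)) L (IsCMField.complexConj L) 3).Local v),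
      (IrrClass.comap (localPiEquiv L (IsCMField.complexConj L) 3 ((StdForm.antidiagonal 3).over L) v) c).IsConstituentOf
          (P'.finRep.smoothPart.toRepresentation.comp
            (inclPlace (↥(maximalRealSubfield L)) L (IsCMField.complexConj L) 3 ((StdForm.antidiagonal 3).over L) v)) ∧
        ∃ (π : SmoothIrrep ((cmDatum L 3 ((StdForm.antidiagonal 3).over L)).Local v)), IrrClass.mk π = c ∧
          ∃ q : (Representation.parabolicIndGL ((splitWitness v hs).1.adicCompletion L) (id : Fin 3 → Fin 3)
              ((Representation.trivial ℂ (Π a : Fin 3, GL {i : Fin 3 // (id : Fin 3 → Fin 3) i = a} ((splitWitness v hs).1.adicCompletion L)) ℂ).twist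
                (∏ a : Fin 3, ((![ξ.splitν₀ μω (splitWitness v hs).1 *
                        ((unramifiedTwist ((splitWitness v hs).1.adicCompletion L) (1 / 2) : QuasiChar ((splitWitness v hs).1.adicCompletion L)).toMonoidHom),
                      ξ.locψ (splitWitness v hs).1,
                      ξ.splitν₀ μω (splitWitness v hs).1 *
                        ((unramifiedTwist ((splitWitness v hs).1.adicCompletion L) (1 / 2) : QuasiChar ((splitWitness v hs).1.adicCompletion L)).toMonoidHom)⁻¹] :
                    Fin 3 → (((splitWitness v hs).1.adicCompletion L)ˣ →* ℂˣ)) a).comp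
                  (Matrix.GeneralLinearGroup.det.comp (Pi.evalMonoidHom (fun a : Fin 3 => GL {i : Fin 3 // (id : Fin 3 → Fin 3) i = a} ((splitWitness v hs).1.adicCompletion L)) a))))).IntertwiningMap
              (π.comap (cmSplitEquiv L ((StdForm.antidiagonal 3).over L) (UnitaryGroup.cmConj_antidiagonal_transpose L 3)
                ((Matrix.isUnit_iff_isUnit_det _).mp (StdForm.isUnit_over (StdForm.antidiagonal 3) L)) v (splitWitness v hs) (splitWitness_spec v hs)).symm).ρ,
            Function.Surjective q)
    -- (ONE-N): at a non-split place, along some frame, SOME local constituent of `P′` is (the transport of) an irreducible QUOTIENT of `i_G(χ_{ξ,v})`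
    (hONEn : ∀ (v : HeightOneSpectrum (𝓞 ↥(maximalRealSubfield L))), (∀ w : PlacesOver L v, IsCMField.complexConj L • w.1 = w.1) →
      ∃ (T : GL (Fin 3) (LocalRing L v)) (a : LocalRing L v) (ha : IsUnit a)
        (h : formCongr (conjLocal L (IsCMField.complexConj L) v) T (((StdForm.antidiagonal 3).over L).map (algebraMap L (LocalRing L v))) =
          a • (Matrix.of fun i j : Fin 3 => if i.val + j.val + 1 = 3 then (1 : L) else 0).map (algebraMap L (LocalRing L v))),
        ∃ c : IrrClass ((quasiSplit (↥(maximalRealSubfield L)) L (IsCMField.complexConj L) 3).Local v),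
          (IrrClass.comap (localPiEquiv L (IsCMField.complexConj L) 3 ((StdForm.antidiagonal 3).over L) v) c).IsConstituentOf
              (P'.finRep.smoothPart.toRepresentation.comp
                (inclPlace (↥(maximalRealSubfield L)) L (IsCMField.complexConj L) 3 ((StdForm.antidiagonal 3).over L) v)) ∧
            ∃ (r : SmoothIrrep (Gqs L v))
              (N : Subrepresentation (cmPrincipalSeries L 3 v (cmXiTorusChar L v (μω.semilocalComponent L v)
                (torusLocalComponent L (IsCMField.complexConj L) v ξ.η) (torusLocalComponent L (IsCMField.complexConj L) v ξ.ψ)))),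
              IrrClass.comap (cmDatumLocalCongr L v T ha h) c = IrrClass.mk r ∧
              Nonempty (r.ρ.Equiv ((cmPrincipalSeries L 3 v (cmXiTorusChar L v (μω.semilocalComponent L v)
                (torusLocalComponent L (IsCMField.complexConj L) v ξ.η) (torusLocalComponent L (IsCMField.complexConj L) v ξ.ψ))).quotient N.toSubmodule
                  fun g _ hx => N.apply_mem_toSubmodule g hx))) :
    ∃ Pv : ∀ v : HeightOneSpectrum (𝓞 ↥(maximalRealSubfield L)), CMLocalAPacket L ((StdForm.antidiagonal 3).over L) v,
      ξ.IsXiLocalFamily (UnitaryGroup.cmConj_antidiagonal_transpose L 3)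
          ((Matrix.isUnit_iff_isUnit_det _).mp (StdForm.isUnit_over (StdForm.antidiagonal 3) L)) μω hμu Pv ∧
      LocalConstituentsIn P' Pv ∧
      ∀ v : HeightOneSpectrum (𝓞 ↥(maximalRealSubfield L)),
        (∀ w : PlacesOver L v, IsCMField.complexConj L • w.1 = w.1) →
        ∀ c : IrrClass ((quasiSplit (↥(maximalRealSubfield L)) L (IsCMField.complexConj L) 3).Local v), c ∈ (Pv v).members →
          ¬ c.IsSupercuspidal ∧
          ∀ [MeasurableSpace ((quasiSplit (↥(maximalRealSubfield L)) L (IsCMField.complexConj L) 3).Local v ⧸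
                Subgroup.center ((quasiSplit (↥(maximalRealSubfield L)) L (IsCMField.complexConj L) 3).Local v))]
            [BorelSpace ((quasiSplit (↥(maximalRealSubfield L)) L (IsCMField.complexConj L) 3).Local v ⧸
                Subgroup.center ((quasiSplit (↥(maximalRealSubfield L)) L (IsCMField.complexConj L) 3).Local v))]
            (μZ : Measure ((quasiSplit (↥(maximalRealSubfield L)) L (IsCMField.complexConj L) 3).Local v ⧸
                Subgroup.center ((quasiSplit (↥(maximalRealSubfield L)) L (IsCMField.complexConj L) 3).Local v)))
            [μZ.IsHaarMeasure], ¬ c.IsSquareIntegrable μZ := by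
  refine res_middleResidue_isPiN_of_quotients L μ μω hμu hμω ξ P' hLQ hKO (fun v hs c hc => ?_) (fun v hns => ?_)
  · exact quotS_of_oneS_of_AFA L μ μω ξ P' hAF v hs (hONEs v hs) c hc
  · obtain ⟨T, a, ha, h, hONE⟩ := hONEn v hns
    exact ⟨T, a, ha, h, fun c hc => quotN_of_oneN_of_AFA L μ μω ξ P' hAF v T a ha h hONE c hc⟩

end Summit.HodgeConjecture.HodgeConjecture.R90.S8

end
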